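import Summits.Parity.GeneralizedHardyLittlewood.Theses.LeeYangFibres
import Summits.Parity.GeneralizedHardyLittlewood.Theorems.LeeYangFibresPrimeCellsRelativeLocator
import Summits.Parity.GeneralizedHardyLittlewood.Theorems.LeeYangFibresPrimeCellsRelativeHardyLittlewoodTools
import Summits.Parity.GeneralizedHardyLittlewood.Theorems.PairsToGHL.Negative.ShiftPairDictionary
import Literature.NumberTheory.Sieve.LinearEquationsInPrimesDimOne
import Literature.NumberTheory.Sieve.LinearEquationsInPrimesCount
import Literature.NumberTheory.LFunctions.RHWave0PNTProofs
import HarnessLib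

/-!
# `PrimeCellsRelative` implies Hardy–Littlewood's Conjecture A (crux stmt-Parity-14112, line `Sketch`)

Hardness certificate for the crux `PrimeCellsRelative` of route `LeeYangFibres`
(Parity / GeneralizedHardyLittlewood): the crux implies the tree's registered open conjecture
`Literature.NumberTheory.Sieve.HardyLittlewoodGoldbach` (parity.S35, the binary Goldbach asymptotic
`R(N) ∼ 𝔖(N) N / log² N` through the even integers, Hardy–Littlewood 1923, Conjecture A), hence
binary Goldbach for all large even `N`, and the same for `RelativeDimOne` (stmt-Parity-14113),
`DimOne` (stmt-Parity-0819) and the summit conjunct `GeneralizedHardyLittlewood`.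

Unlike the prime-tuples certificate (`…HardyLittlewoodTuples`), this one USES the shift-uniformity
of the crux (the load-bearing size bound `‖Ψ‖_N ≤ L` of `Negative/FalseWithoutSizeBound`): the
Goldbach systems `(n, N - n)` (`Literature.NumberTheory.Sieve.goldbachSystem`) vary with `N` but have
`‖·‖_N ≤ 3`, so one threshold of the crux serves every even `N`.

Dictionary (this file): `(n, N - n)` is non-degenerate for `N ≠ 0`; it has the same good residues,
local factors and singular product as the shift pair `(n, n + N)` of
`Theorems/PairsToGHL/Negative/ShiftPairDictionary`, namely `𝔖(N) = 2 C₂ ∏_{p ∣ N, p>2} (p-1)/(p-2)`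
for even `N` (`singularProduct_goldbachSystem`); `β_∞([0, N]) = N`; and its prime-point count on
`[0, N]` is `R(N)` (`goldbachCount_eq_primePointCount`). The asymptotic is then assembled exactly
as for tuples (`…HardyLittlewoodTools`: PNT window, error count, `hl_arith` at `k = 2`), with the
crux taken at precision `ε = min(1/2, δ C₂/(4(4C₂+1)))` and `𝔖(N) ≥ 2 C₂ > 0`
(`two_mul_twinPrimeConst_le_goldbachSingularSeries`).

References: G. H. Hardy, J. E. Littlewood, Acta Math. 44 (1923), §4.1 Conjecture A (4.11)–(4.12)
p. 32 [HardyLittlewood1923]; B. Green, T. Tao, Ann. of Math. 171 (2010), Conj. 1.2 / 1.4,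
Examples 1–2 [GreenTao2010].
-/

noncomputable section

namespace Summit.Parity.GeneralizedHardyLittlewood.Cruxes.PrimeCellsRelative.Sketch

open scoped BigOperators Topology Classical
open Filter Finset Asymptotics MeasureTheory Literature.NumberTheory.Sieve
open Summit.Parity.GeneralizedHardyLittlewood.Theses.LeeYangFibres
open Summit.Parity.GeneralizedHardyLittlewood.Theorems.LeeYangFibresCells
open Summit.Parity.GeneralizedHardyLittlewood.Theorems.PairsToGHL.Negative

/-! ### The Goldbach system `(n, N - n)` as Green–Tao data -/

/-- `ψ₁(n) = n₀`. [cite: GreenTao2010, Example 2] -/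
theorem goldbachSystem_eval_zero (M : ℤ) (n : Fin 1 → ℤ) : (goldbachSystem M 0).eval n = n 0 := by
  simp [goldbachSystem, AffLinForm.eval]

/-- `ψ₂(n) = -n₀ + N`. [cite: GreenTao2010, Example 2] -/
theorem goldbachSystem_eval_one (M : ℤ) (n : Fin 1 → ℤ) :
    (goldbachSystem M 1).eval n = -n 0 + M := by
  simp [goldbachSystem, AffLinForm.eval]

/-- The Goldbach system `(n, N - n)` is non-degenerate for `N ≠ 0`. [cite: GreenTao2010, Def. 1.1] -/
theorem isNondegenerateSystem_goldbachSystem {M : ℤ} (hM : M ≠ 0) :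
    IsNondegenerateSystem (goldbachSystem M) := by
  refine ⟨fun i => ?_, fun i j hij a b hab => ?_⟩
  · fin_cases i <;> simp [goldbachSystem]
  · have h0 := hab (fun _ => 0)
    have h1 := hab (fun _ => 1)
    have e00 : (goldbachSystem M 0).eval (fun _ => 0) = 0 := by rw [goldbachSystem_eval_zero]
    have e01 : (goldbachSystem M 0).eval (fun _ => 1) = 1 := by rw [goldbachSystem_eval_zero]
    have e10 : (goldbachSystem M 1).eval (fun _ => 0) = M := by rw [goldbachSystem_eval_one]; ring
    have e11 : (goldbachSystem M 1).eval (fun _ => 1) = M - 1 := by rw [goldbachSystem_eval_one]; ring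
    fin_cases i <;> fin_cases j
    · exact absurd rfl hij
    · simp only [Fin.zero_eta, Fin.mk_one, e00, e01, e10, e11, mul_zero, mul_one] at h0 h1
      have hb : b = 0 := by
        rcases mul_eq_zero.mp h0.symm with h | h
        · exact h
        · exact absurd h hM
      subst hb
      simp only [zero_mul] at h1
      exact ⟨h1, rfl⟩
    · simp only [Fin.zero_eta, Fin.mk_one, e00, e01, e10, e11, mul_zero, mul_one] at h0 h1
      have ha : a = 0 := by
        rcases mul_eq_zero.mp h0 with h | h
        · exact h
        · exact absurd h hM
      subst ha
      simp only [zero_mul] at h1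
      exact ⟨rfl, h1.symm⟩
    · exact absurd rfl hij

/-- `‖(n, N - n)‖_N = 1 + 1 + 0 + N/N = 3` (`N ≥ 1`). [cite: GreenTao2010, (1.1)] -/
theorem affLinSize_goldbachSystem_le {N : ℕ} (hN : 1 ≤ N) :
    affLinSize (goldbachSystem (N : ℤ)) (N : ℝ) ≤ ((3 : ℕ) : ℝ) := by
  have hN0 : (N : ℝ) ≠ 0 := by positivity
  unfold affLinSize
  simp [goldbachSystem, Fin.sum_univ_two, hN0]
  norm_num

/-- Same good residues as the shift pair `(n, n + N)`: `v ≢ 0, N - v ≢ 0` versus `v ≢ 0, v + N ≢ 0`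
(`v ↦ -v`), so `#good = p - #{0, -N}` in both cases. [cite: GreenTao2010, Examples 1–2] -/
theorem goodCount_goldbachSystem (M : ℤ) (p : ℕ) [Fact p.Prime] :
    goodCount (goldbachSystem M) p = goodCount (shiftPairSystem M) p := by
  classical
  have hz : ∀ v : Fin 1 → ZMod p, (goldbachSystem M 0).modEval p v = v 0 := fun v => by
    simp [goldbachSystem, AffLinForm.modEval]
  have ho : ∀ v : Fin 1 → ZMod p, (goldbachSystem M 1).modEval p v = -v 0 + (M : ZMod p) := fun v => by
    simp [goldbachSystem, AffLinForm.modEval]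
  have hz' : ∀ v : Fin 1 → ZMod p, (shiftPairSystem M 0).modEval p v = v 0 := fun v => by
    simp [shiftPairSystem, AffLinForm.modEval]
  have ho' : ∀ v : Fin 1 → ZMod p, (shiftPairSystem M 1).modEval p v = v 0 + (M : ZMod p) := fun v => by
    simp [shiftPairSystem, AffLinForm.modEval]
  unfold goodCount
  refine Finset.card_nbij' (fun v => -v) (fun v => -v) (fun v hv => ?_) (fun v hv => ?_)
    (fun v _ => neg_neg v) (fun v _ => neg_neg v)
  · simp only [Finset.coe_filter, Finset.mem_univ, true_and, Set.mem_setOf_eq, Fin.forall_fin_two,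
      hz, ho, hz', ho', Pi.neg_apply, neg_eq_zero] at hv ⊢
    exact ⟨hv.1, fun h' => hv.2 (by linear_combination h')⟩
  · simp only [Finset.coe_filter, Finset.mem_univ, true_and, Set.mem_setOf_eq, Fin.forall_fin_two,
      hz, ho, hz', ho', Pi.neg_apply, neg_eq_zero, neg_neg] at hv ⊢
    exact ⟨hv.1, fun h' => hv.2 (by linear_combination h')⟩

/-- Hence the same local factors … [cite: GreenTao2010, (1.6)] -/
theorem localFactor_goldbachSystem {M : ℤ} {p : ℕ} (hp : p.Prime) :
    localFactor (goldbachSystem M) p = localFactor (shiftPairSystem M) p := by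
  haveI := Fact.mk hp
  rw [localFactor_prime, localFactor_prime, goodCount_goldbachSystem]

/-- … and the same singular product, which for even `N ≠ 0` is the Goldbach singular series
`𝔖(N) = 2 C₂ ∏_{p ∣ N, p > 2} (p-1)/(p-2)` (`singularProduct_shiftPairSystem`, tree).
[cite: HardyLittlewood1923, Conjecture A (4.11)] -/
theorem singularProduct_goldbachSystem {N : ℕ} (hN : Even N) (h0 : N ≠ 0) :
    singularProduct (goldbachSystem (N : ℤ)) = goldbachSingularSeries N := by
  rw [← singularProduct_shiftPairSystem hN h0]
  unfold singularProduct
  congr 1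
  funext x
  unfold singularProductPartial
  exact Finset.prod_congr rfl fun p hp => localFactor_goldbachSystem (Nat.mem_primesLE.mp hp).2

/-- `β_∞((n, N - n), [0, N]) = N`: the slice `{0 ≤ r ≤ N : r > 0, N - r > 0}` is `(0, N)`.
[cite: GreenTao2010, (1.4)] -/
theorem archFactor_goldbachSystem (N : ℕ) :
    archFactor (goldbachSystem (N : ℤ)) (Set.Icc (fun _ : Fin 1 => (0 : ℝ)) (fun _ => (N : ℝ))) = N := by
  rw [DimOne.archFactor_eq]
  have hS : {r : ℝ | (fun _ : Fin 1 => r) ∈ Set.Icc (fun _ : Fin 1 => (0 : ℝ)) (fun _ => (N : ℝ)) ∧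
      ∀ i, 0 < (goldbachSystem (N : ℤ) i).realEval fun _ => r} = Set.Ioo (0 : ℝ) N := by
    ext r
    simp only [Set.mem_setOf_eq, Set.mem_Icc, Pi.le_def, Set.mem_Ioo, Fin.forall_fin_two,
      Fin.forall_fin_one]
    simp only [goldbachSystem, AffLinForm.realEval, Fin.sum_univ_one, Matrix.cons_val_zero,
      Matrix.cons_val_one, Int.cast_one, one_mul, Int.cast_zero, add_zero, Int.cast_neg,
      Int.cast_natCast, neg_mul]
    constructor
    · rintro ⟨-, h1, h2⟩; exact ⟨h1, by linarith⟩
    · rintro ⟨h1, h2⟩; exact ⟨⟨h1.le, h2.le⟩, h1, by linarith⟩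
  rw [hS, Real.volume_Ioo, sub_zero, ENNReal.toReal_ofReal (Nat.cast_nonneg N)]

/-- **The Goldbach count is Green–Tao's prime-point count** of `(n, N - n)` on `[0, N]`:
`R(N) = #{(p, q) : p + q = N, p, q prime} = #{0 ≤ n ≤ N : n, N - n prime}`.
[cite: HardyLittlewood1923, Conjecture A] -/
theorem goldbachCount_eq_primePointCount (N : ℕ) :
    SingularSeries.goldbachCount N = primePointCount (goldbachSystem (N : ℤ))
      (Set.Icc (fun _ : Fin 1 => (0 : ℝ)) (fun _ => (N : ℝ))) N := by
  have hev0 : ∀ m : ℤ, (goldbachSystem (N : ℤ) 0).eval (fun _ => m) = m := fun m => by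
    rw [goldbachSystem_eval_zero]
  have hev1 : ∀ m : ℤ, (goldbachSystem (N : ℤ) 1).eval (fun _ => m) = -m + N := fun m => by
    rw [goldbachSystem_eval_one]
  unfold SingularSeries.goldbachCount primePointCount
  rw [DimOne.card_filter_latticeBox]
  symm
  refine Finset.card_nbij' (fun m : ℤ => (m.toNat, N - m.toNat)) (fun pq : ℕ × ℕ => (pq.1 : ℤ))
    (fun m hm => ?_) (fun pq hpq => ?_) (fun m hm => ?_) (fun pq hpq => ?_)
  · simp only [Finset.mem_coe, Finset.mem_filter, Finset.mem_Icc, DimOne.realPoint_const,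
      Set.mem_Icc, Pi.le_def, Fin.forall_fin_two, hev0, hev1] at hm
    obtain ⟨-, hK, hP0, hP1⟩ := hm
    have h1 : (0 : ℝ) ≤ m := hK.1 0
    have h2 : (m : ℝ) ≤ N := hK.2 0
    have h1' : 0 ≤ m := by exact_mod_cast h1
    have h2' : m ≤ N := by exact_mod_cast h2
    have hm0 : (m.toNat : ℤ) = m := Int.toNat_of_nonneg h1'
    have hle : m.toNat ≤ N := by
      have : (m.toNat : ℤ) ≤ (N : ℤ) := by rw [hm0]; exact h2'
      exact_mod_cast this
    have hcast : ((N - m.toNat : ℕ) : ℤ) = -m + N := by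
      rw [Nat.cast_sub hle, hm0]; ring
    simp only [Finset.mem_coe, Finset.mem_filter, Finset.HasAntidiagonal.mem_antidiagonal]
    refine ⟨by omega, ?_, ?_⟩
    · have h := hP0
      rw [← hm0, Int.toNat_natCast] at h
      exact h
    · have h := hP1
      rw [← hcast, Int.toNat_natCast] at h
      exact h
  · simp only [Finset.mem_coe, Finset.mem_filter, Finset.HasAntidiagonal.mem_antidiagonal] at hpq
    obtain ⟨hsum, hp, hq⟩ := hpq
    simp only [Finset.mem_coe, Finset.mem_filter, Finset.mem_Icc, DimOne.realPoint_const,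
      Set.mem_Icc, Pi.le_def, Fin.forall_fin_two, hev0, hev1, Int.cast_natCast, Int.toNat_natCast]
    have hle : pq.1 ≤ N := by omega
    refine ⟨⟨by omega, by omega⟩, ⟨fun _ => by positivity, fun _ => by exact_mod_cast hle⟩, hp, ?_⟩
    have hcast : (-(pq.1 : ℤ) + N) = ((pq.2 : ℕ) : ℤ) := by omega
    rw [hcast, Int.toNat_natCast]
    exact hq
  · simp only [Finset.mem_coe, Finset.mem_filter, DimOne.realPoint_const, Set.mem_Icc,
      Pi.le_def] at hm
    obtain ⟨-, hK, -⟩ := hm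
    have h1 : (0 : ℝ) ≤ m := hK.1 0
    exact Int.toNat_of_nonneg (by exact_mod_cast h1)
  · simp only [Finset.mem_coe, Finset.mem_filter, Finset.HasAntidiagonal.mem_antidiagonal] at hpq
    obtain ⟨hsum, -, -⟩ := hpq
    refine Prod.ext ?_ ?_
    · simp
    · simp only [Int.toNat_natCast]; omega

/-! ### Hardy–Littlewood's Conjecture A from the crux -/

/-- **Hardness certificate: `PrimeCellsRelative → HardyLittlewoodGoldbach`** (parity.S35, the
Hardy–Littlewood Goldbach asymptotic `R(N) ∼ 𝔖(N) N/log² N` through the even integers, registered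
open in the tree; it contains binary Goldbach for all large even `N`). This certificate USES the
shift-uniformity of the crux: the systems `(n, N - n)` change with `N` but have `‖·‖_N ≤ 3`, so ONE
threshold of the crux serves every even `N`; the dictionary above gives `∏_p β_p = 𝔖(N) ≥ 2C₂ > 0`,
`β_∞([0, N]) = N` and prime-point count `= R(N)`; the rest is the prime number theorem window and
`hl_arith` at `k = 2`. Registered helper of crux stmt-Parity-14112 (line `Sketch`).
[cite: HardyLittlewoodPN3, §4.1 Conjecture A (4.11)–(4.12) p. 32; GreenTao2010, Conj. 1.4] -/
theorem primeCellsRelative_implies_hardyLittlewoodGoldbach (hP : PrimeCellsRelative) :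
    HardyLittlewoodGoldbach := by
  rw [HardyLittlewoodGoldbach, Asymptotics.IsEquivalent, Asymptotics.isLittleO_iff]
  intro δ₀ hδ₀
  rw [Filter.eventually_inf_principal]
  -- work at precision `δ = min δ₀ 1`
  set δ : ℝ := min δ₀ 1 with hδdef
  have hδ : 0 < δ := lt_min hδ₀ one_pos
  have hδ1 : δ ≤ 1 := min_le_right _ _
  have hδδ₀ : δ ≤ δ₀ := min_le_left _ _
  have hC₂ : 0 < twinPrimeConst := twinPrimeConst_pos_holds
  set s₀ : ℝ := 2 * twinPrimeConst with hs₀def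
  have hs₀ : 0 < s₀ := by positivity
  obtain ⟨η, hη0, hη12, hηup, hηlo⟩ := exists_eta_pow_near_one 2 (by positivity : 0 < δ / 8)
  set ε : ℝ := min (1 / 2) (δ / 8 * s₀ / (2 * s₀ + 1)) with hεdef
  have hε0 : 0 < ε := lt_min (by norm_num) (by positivity)
  have hε' : ε ≤ δ / 8 * s₀ / (2 * s₀ + 1) := min_le_right _ _
  set c : ℝ := δ * s₀ / 48 with hcdef
  have hc : 0 < c := by positivity
  obtain ⟨u, hu, N₀, hN₀⟩ := hP 2 3 (by norm_num) ε hε0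
  have hwin := eventually_primeCounting_window hη0
  have hgrow := eventually_log_growth 2 1 hη0 hc hc
  filter_upwards [hwin, hgrow, eventually_ge_atTop N₀, eventually_ge_atTop 1] with N hNwin hNgr
    hNN₀ hN1 hNeven
  have hNeven' : Even N := hNeven
  obtain ⟨hlog1, -, -, hlogk⟩ := hNgr
  have hN0 : N ≠ 0 := by omega
  have hN1' : (1 : ℝ) ≤ N := by exact_mod_cast hN1
  have hN0' : (0 : ℝ) < N := by linarith
  have hlog : 0 < Real.log N := by linarith
  have hss₀ : s₀ ≤ goldbachSingularSeries N :=
    two_mul_twinPrimeConst_le_goldbachSingularSeries hNeven'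
  have hs : 0 < goldbachSingularSeries N := lt_of_lt_of_le hs₀ hss₀
  -- the Goldbach system and its dictionary
  have hnd : IsNondegenerateSystem (goldbachSystem (N : ℤ)) :=
    isNondegenerateSystem_goldbachSystem (by exact_mod_cast hN0)
  have haff := affLinSize_goldbachSystem_le hN1
  have hsing := singularProduct_goldbachSystem hNeven' hN0
  have hcount := goldbachCount_eq_primePointCount N
  have hβ := archFactor_goldbachSystem N
  set K : Set (Fin 1 → ℝ) := Set.Icc (fun _ : Fin 1 => (0 : ℝ)) (fun _ => (N : ℝ)) with hK
  have hKc : Convex ℝ K := convex_Icc _ _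
  have hKB : K ⊆ realBox 1 N := by
    refine Set.Icc_subset_Icc (fun _ => ?_) le_rfl
    show -(N : ℝ) ≤ 0
    linarith
  have hb := hN₀ N hNN₀ (goldbachSystem (N : ℤ)) hnd haff K hKc hKB
  rw [hsing] at hb
  have hZ0 : 0 ≤ (N : ℝ) ^ ((1 : ℝ) / u) := Real.rpow_nonneg (Nat.cast_nonneg N) _
  -- assemble
  rw [Pi.sub_apply, Real.norm_eq_abs, Real.norm_eq_abs, hcount]
  refine le_trans ?_ (mul_le_mul_of_nonneg_right hδδ₀ (abs_nonneg _))
  refine hl_arith 2 hb (card_cells_le_primePointCount N _ (goldbachSystem (N : ℤ)) K)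
    (primePointCount_le_card_cells_add hZ0 (goldbachSystem (N : ℤ)) hnd K) hN0' hlog hs hδ hδ1
    hε0.le ?_ ?_ ?_ (le_of_eq hβ) ?_ ?_
  · -- `ε (2𝔖 + 1) ≤ (δ/8) 𝔖` from `ε ≤ (δ/8) s₀/(2 s₀ + 1)` and `s₀ ≤ 𝔖`
    calc ε * (2 * goldbachSingularSeries N + 1)
        ≤ δ / 8 * s₀ / (2 * s₀ + 1) * (2 * goldbachSingularSeries N + 1) :=
          mul_le_mul_of_nonneg_right hε' (by linarith)
      _ ≤ δ / 8 * goldbachSingularSeries N := by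
          rw [div_mul_eq_mul_div, div_le_iff₀ (by positivity)]
          nlinarith [mul_nonneg hδ.le (sub_nonneg.mpr hss₀)]
  · -- the error count
    have h := errCount_mul_log_pow_le (k := 2) hN1' hu hlog1 hlogk
    have h3 : 3 * ((2 : ℕ) : ℝ) * c * N = δ / 8 * (s₀ * N) := by rw [hcdef]; push_cast; ring
    rw [h3] at h
    refine h.trans ?_
    have := mul_le_mul_of_nonneg_right hss₀ hN0'.le
    nlinarith
  · rw [hβ]; nlinarith
  · refine hηlo.trans (pow_le_pow_left₀ (by linarith) ?_ _)
    exact (roughDensity_window hNwin hN1 hu).1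
  · refine le_trans (pow_le_pow_left₀ ?_ ?_ _) hηup
    · exact mul_nonneg (div_nonneg (Nat.cast_nonneg _) (Nat.cast_nonneg _)) hlog.le
    · exact (roughDensity_window hNwin hN1 hu).2

/-! ### Corollaries -/

/-- The crux gives binary Goldbach for all large even `N` (Hardy–Littlewood's "every large even
number is the sum of two odd primes", via the tree's
`HardyLittlewoodGoldbach.exists_forall_exists_prime_add_eq`).
[cite: HardyLittlewoodPN3, §4.1 Conjecture A p. 32] -/
theorem primeCellsRelative_implies_eventual_goldbach (hP : PrimeCellsRelative) :
    ∃ N₀ : ℕ, ∀ N : ℕ, N₀ ≤ N → Even N → ∃ p q : ℕ, p.Prime ∧ q.Prime ∧ p + q = N :=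
  (primeCellsRelative_implies_hardyLittlewoodGoldbach hP).exists_forall_exists_prime_add_eq

/-- `RelativeDimOne` (stmt-Parity-14113) implies Hardy–Littlewood's Conjecture A.
[cite: GreenTao2010, Conj. 1.4] -/
theorem relativeDimOne_implies_hardyLittlewoodGoldbach (hR : RelativeDimOne) :
    HardyLittlewoodGoldbach :=
  primeCellsRelative_implies_hardyLittlewoodGoldbach (primeCellsRelative_of_relativeDimOne hR)

/-- `DimOne` (stmt-Parity-0819) implies Hardy–Littlewood's Conjecture A. [cite: GreenTao2010, Conj. 1.2] -/
theorem dimOne_implies_hardyLittlewoodGoldbach (hD : DimOne) : HardyLittlewoodGoldbach :=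
  primeCellsRelative_implies_hardyLittlewoodGoldbach (primeCellsRelative_of_dimOne hD)

/-- **The summit conjunct implies Hardy–Littlewood's Conjecture A** (the binary Goldbach
asymptotic): Green–Tao Conj. 1.2 at `d = 1` for the systems `(n, N - n)`, uniformly in `N`.
[cite: GreenTao2010, Conj. 1.2 and Example 2] -/
theorem generalizedHardyLittlewood_implies_hardyLittlewoodGoldbach
    (hG : _root_.GeneralizedHardyLittlewood) : HardyLittlewoodGoldbach :=
  primeCellsRelative_implies_hardyLittlewoodGoldbach (primeCellsRelative_of_generalizedHardyLittlewood hG)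

end Summit.Parity.GeneralizedHardyLittlewood.Cruxes.PrimeCellsRelative.Sketch

end
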